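import Mathlib
import Literature.NumberTheory.LFunctions.RiemannXi
import Literature.NumberTheory.LFunctions.RiemannXiProofs
import Summits.RiemannHypothesis.RiemannHypothesis.Theorems.SuzukiWeightedDoorDefs
import Summits.RiemannHypothesis.RiemannHypothesis.Theorems.SuzukiWeightedDoorRung
import Summits.RiemannHypothesis.RiemannHypothesis.Theorems.SuzukiWeightedDoorConverse
import Summits.RiemannHypothesis.RiemannHypothesis.Theorems.SuzukiWeightedDoorDoor

/-!
# SuzukiWeightedDoor — THE RUNG LEAF `GrowthAbscissaIdentity`, PROVED (RH-FREE identity; module 6/6)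

`growthAbscissaIdentity_holds : SuzukiWeightedDoor.GrowthAbscissaIdentity` — for every `θ > 10` and `η ≥ 0`:
`WeightedWitness θ η → XiZeroFreeAbove (1/2 + η)` (module 5, `shiftedDoor`) and
`XiZeroFreeAbove σ₀ → WeightedWitness θ η` for `1/2 ≤ σ₀ < 1/2 + η` (module 4, `witnessOfZeroFree`).
An identity between two RH-free quantities (the `L²`-growth abscissa of Suzuki's single window function `W_θ` and the
zero-free abscissa of `ξ`), true whatever the truth of RH; RH is the unasserted value `η = 0 ∧ WeightedWitness θ 0`
(= route DeBrangesSuzukiDoor's declared residual `DoorWitness`).  §1 B-P(P3) rung CANDIDATE for the ladder author.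
Nothing here bears on the truth of RH.
-/

set_option linter.dupNamespace false

noncomputable section

namespace Summit.RiemannHypothesis.RiemannHypothesis.Theorems.SuzukiWeightedDoor

/-- **THE RUNG LEAF, PROVED (RH-FREE identity)** — `GrowthAbscissaIdentity` BY NAME. -/
theorem growthAbscissaIdentity_holds : GrowthAbscissaIdentity :=
  fun θ hθ η hη => ⟨SuzukiWeightedDoorDoor.shiftedDoor θ hθ η hη,
    fun σ₀ h₁ h₂ hZ => SuzukiWeightedDoorConverse.witnessOfZeroFree θ hθ η σ₀ h₁ h₂ hZ⟩

/-- The leaf in unfolded form (verbatim the kit's route item `GrowthAbscissaIdentity`, over `SuzukiDoor.limWindowAvg`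
and `riemannXi` only). -/
theorem growthAbscissaIdentity : ∀ θ : ℝ, 10 < θ → ∀ η : ℝ, 0 ≤ η →
    (MeasureTheory.MemLp (fun x : ℝ => Real.exp (-η * x) *
        Summit.RiemannHypothesis.RiemannHypothesis.Theorems.SuzukiDoor.limWindowAvg θ x) 2 MeasureTheory.volume →
      ∀ s : ℂ, 1 / 2 + η < s.re → Literature.NumberTheory.LFunctions.riemannXi s ≠ 0) ∧
    (∀ σ₀ : ℝ, 1 / 2 ≤ σ₀ → σ₀ < 1 / 2 + η →
      (∀ s : ℂ, σ₀ < s.re → Literature.NumberTheory.LFunctions.riemannXi s ≠ 0) →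
        MeasureTheory.MemLp (fun x : ℝ => Real.exp (-η * x) *
          Summit.RiemannHypothesis.RiemannHypothesis.Theorems.SuzukiDoor.limWindowAvg θ x) 2 MeasureTheory.volume) :=
  growthAbscissaIdentity_holds

/-- Monotonicity of the weighted witness in the height (RH-FREE): `W_θ` vanishes on `(−∞,−1]` ((K-iii), `θ > 1`), so
`|e^{−η′x} W_θ(x)| ≤ e^{η′−η} |e^{−ηx} W_θ(x)|` for `η ≤ η′`. -/
theorem weightedWitness_mono {θ η η' : ℝ} (hθ : 1 < θ) (h : WeightedWitness θ η) (hle : η ≤ η') :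
    WeightedWitness θ η' := by
  have hK0 : ∀ x : ℝ, x < 0 → SuzukiDoor.limKernel θ x = 0 := fun x hx =>
    Literature.NumberTheory.LFunctions.Suzuki2020_thm12_Kiii hθ hx
  have hW0 : ∀ u : ℝ, u ≤ -1 → SuzukiDoor.limWindowAvg θ u = 0 := fun u hu =>
    SuzukiDoor.window_eq_zero_of_le hK0 hu
  unfold WeightedWitness at h ⊢
  have hmeas : MeasureTheory.AEStronglyMeasurable
      (fun x : ℝ => Real.exp (-η' * x) * SuzukiDoor.limWindowAvg θ x) MeasureTheory.volume := by
    have h1 : (fun x : ℝ => Real.exp (-η' * x) * SuzukiDoor.limWindowAvg θ x) =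
        fun x : ℝ => Real.exp (-(η' - η) * x) * (Real.exp (-η * x) * SuzukiDoor.limWindowAvg θ x) := by
      funext x
      rw [← mul_assoc, ← Real.exp_add]
      ring_nf
    rw [h1]
    exact ((Real.continuous_exp.comp (continuous_const.mul continuous_id)).aestronglyMeasurable).mul
      h.aestronglyMeasurable
  refine h.of_le_mul hmeas (c := Real.exp (η' - η)) (Filter.Eventually.of_forall fun x => ?_)
  by_cases hx : x ≤ -1
  · simp [hW0 x hx]
  · push Not at hx
    rw [Real.norm_eq_abs, Real.norm_eq_abs, abs_mul, abs_mul, Real.abs_exp, Real.abs_exp, ← mul_assoc,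
      ← Real.exp_add]
    refine mul_le_mul_of_nonneg_right (Real.exp_le_exp.2 ?_) (abs_nonneg _)
    nlinarith [mul_nonneg (sub_nonneg.2 hle) (show (0 : ℝ) ≤ x + 1 by linarith)]

/-- **The growth-abscissa EQUATION (RH-FREE):** for every `θ > 10`, the `L²`-growth abscissa of Suzuki's single window
function `W_θ` equals the clamped zero-free abscissa of `ξ` minus `1/2`.  Both sides are RH-free real numbers; RH is the
unasserted statement that either equals `0` together with attainment (route DeBrangesSuzukiDoor's residual). -/
theorem growthAbscissa_eq {θ : ℝ} (hθ : 10 < θ) : growthAbscissa θ = xiZeroFreeAbscissa - 1 / 2 := by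
  have hId := growthAbscissaIdentity_holds θ hθ
  set A : Set ℝ := {η : ℝ | 0 ≤ η ∧ WeightedWitness θ η} with hA
  set B : Set ℝ := {σ₀ : ℝ | 1 / 2 ≤ σ₀ ∧ XiZeroFreeAbove σ₀} with hB
  have hAne : A.Nonempty := ⟨1, by norm_num, SuzukiWeightedDoorRung.weightedWitness_of_half_lt θ hθ 1 (by norm_num)⟩
  have hBne : B.Nonempty := ⟨1, by norm_num, xiZeroFreeAbove_one⟩
  have hAbdd : BddBelow A := ⟨0, fun η hη => hη.1⟩
  have hBbdd : BddBelow B := ⟨1 / 2, fun σ hσ => hσ.1⟩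
  show sInf A = sInf B - 1 / 2
  apply le_antisymm
  · -- sInf A ≤ sInf B − 1/2: approximate sInf B from inside B and use the converse direction
    refine le_of_forall_pos_le_add fun ε hε => ?_
    obtain ⟨σ₀, hσ₀B, hσ₀lt⟩ := Real.lt_sInf_add_pos hBne (half_pos hε)
    have hη0 : 0 ≤ σ₀ - 1 / 2 + ε / 2 := by linarith [hσ₀B.1]
    have hWW : WeightedWitness θ (σ₀ - 1 / 2 + ε / 2) :=
      (hId (σ₀ - 1 / 2 + ε / 2) hη0).2 σ₀ hσ₀B.1 (by linarith) hσ₀B.2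
    have hmem : σ₀ - 1 / 2 + ε / 2 ∈ A := ⟨hη0, hWW⟩
    calc sInf A ≤ σ₀ - 1 / 2 + ε / 2 := csInf_le hAbdd hmem
      _ ≤ sInf B - 1 / 2 + ε := by linarith
  · -- sInf B − 1/2 ≤ sInf A: every admissible height gives a zero-free half-plane (the door direction)
    have h : ∀ η ∈ A, sInf B ≤ η + 1 / 2 := fun η hη => by
      have hmem : 1 / 2 + η ∈ B := ⟨by linarith [hη.1], (hId η hη.1).1 hη.2⟩
      calc sInf B ≤ 1 / 2 + η := csInf_le hBbdd hmem
        _ = η + 1 / 2 := by ring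
    exact le_csInf hAne fun η hη => by linarith [h η hη]

end Summit.RiemannHypothesis.RiemannHypothesis.Theorems.SuzukiWeightedDoor

end
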